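import Literature.NumberTheory.LFunctions.ClassGroupLogFreeTheorem14
import Literature.NumberTheory.LFunctions.DedekindZeta1LogFreeLemmaB
import HarnessLib

/-!
# Bombieri's Théorème 14 for `ζ₁_K` (the trivial class group character), uniformly in the field

Topic `Literature/NumberTheory/LFunctions`, namespace `Literature.NumberTheory.LFunctions.NumberField`.
Everything here is PROVED (theorems only; no named facts).

The `χ = 1` member of `ClassGroupLogFreeTheorem14`: the zeros of `ζ_K` (= zeros of the entire
`ζ₁_K = dedekindZeta₁ K`, none on `Re s ≥ 1`) for a number field `K` of degree `n_K ≤ 2`, with the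
size parameter `P ≥ 2` dominating `|d_K|`, `h_K`, `1/κ_K` and the heights.  Away from the pole in
height (`|γ| ≥ (4e^{10}+1) r`) Lemme B for `ζ₁_K` (`lemmeB_dedekindZeta₁`) and the `ψ = 0` term of
the sieve side give the middle range exactly as for `χ ≠ 1`; the zeros with `|γ| < (4e^{10}+1) r`
and `1 − β ≤ r/2` lie within `(4e^{10}+2) r` of `s = 1` and are counted by the Lemme de densité:

* `overlap_le_Z1`, `zeroSide_Z1` — the zero side for `ζ₁_K` away from the pole;
* `middleRange_Z1` — `Σ_{ρ ∈ Z, β ≥ α} m(ρ) ≤ C P^{A(1−α)}` for `c₀/log P ≤ 1 − α ≤ δ₀`;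
* `smallRange_Z1`, `largeRange_Z1`, `logFreeDensity_dedekindZeta₁` — **the log-free zero-density
  estimate for `ζ_K`**: `Σ_{ρ ∈ Z, β ≥ α} m(ρ) ≤ C_D P^{c_D(1−α)}` (finite sets `Z` of zeros of `ζ_K` with
  `1/4 ≤ β < 1`, `|γ| ≤ P`; all `0 ≤ α ≤ 1`).

## References

* [Bombieri1987GrandCrible] E. Bombieri, Astérisque 18 (1987), §6 Théorème 14 (the case of `ζ`).
* [ThornerZaman2017] J. Thorner, A. Zaman, Algebra Number Theory 11 (2017), §5 (Lemma 5.4, Theorem 5.3).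
-/

noncomputable section

open Complex Finset Filter Real MeasureTheory
open scoped LSeries.notation ArithmeticFunction.vonMangoldt Topology Nat

namespace Literature.NumberTheory.LFunctions.NumberField

open Literature.NumberTheory.LFunctions.LogFreeLocal Literature.NumberTheory.LFunctions.LogFreeDensity
  Literature.NumberTheory.LFunctions.AbelianDensity
open scoped nonZeroDivisors _root_.NumberField

variable {K : Type*} [Field K] [NumberField K]

/-! ### The zero side for `ζ₁_K` away from the pole -/

/-- The `ζ₁_K`-version of the overlap count: the multiplicity-weighted number of zeros of `ζ_K` with
`1 − β ≤ r/2` and `|γ − v| ≤ r/2` is at most `8(1 + r ℒ'_v)`. [cite: Bombieri1987GrandCrible, §6 Théorème 14 (proof)] -/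
theorem overlap_le_Z1 {r : ℝ} (hr : 0 < r) (hr4 : r ≤ 1 / 4)
    (Zρ : Finset ℂ) (hZ : ∀ ρ ∈ Zρ, dedekindZeta₁ K ρ = 0 ∧ 1 - r / 2 ≤ ρ.re ∧ ρ.re < 1) (v : ℝ) :
    ∑ ρ ∈ Zρ.filter (fun ρ => |ρ.im - v| ≤ r / 2), (zeroOrder (dedekindZeta₁ K) ρ : ℝ) ≤
      8 * (1 + r * lemmaAHeight K v) := by
  classical
  set f := dedekindZeta₁ K with hf
  have hdf : Differentiable ℂ f := differentiable_dedekindZeta₁ K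
  have hfc : f (2 + (v : ℂ) * I) ≠ 0 := dedekindZeta₁_two_add_ne_zero v
  set W := Zρ.filter (fun ρ => |ρ.im - v| ≤ r / 2) with hW
  have hmem : ∀ ρ ∈ W, ρ ∈ discZeros f v ∧ ‖ρ - (1 + (v : ℂ) * I)‖ ≤ r := by
    intro ρ hρ
    rw [hW, mem_filter] at hρ
    obtain ⟨hρZ, hγ⟩ := hρ
    obtain ⟨h0, hβ, hβ1⟩ := hZ ρ hρZ
    have hnorm : ‖ρ - (1 + (v : ℂ) * I)‖ ≤ r := by
      have hre : (ρ - (1 + (v : ℂ) * I)).re = ρ.re - 1 := by simp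
      have him : (ρ - (1 + (v : ℂ) * I)).im = ρ.im - v := by simp
      calc ‖ρ - (1 + (v : ℂ) * I)‖ ≤ |(ρ - (1 + (v : ℂ) * I)).re| + |(ρ - (1 + (v : ℂ) * I)).im| :=
            Complex.norm_le_abs_re_add_abs_im _
        _ ≤ r / 2 + r / 2 := by
            rw [hre, him]
            refine add_le_add ?_ hγ
            rw [abs_sub_comm, abs_of_nonneg (by linarith)]; linarith
        _ = r := by ring
    refine ⟨(mem_discZeros hdf hfc).2 ⟨?_, h0⟩, hnorm⟩
    rw [Metric.mem_closedBall, dist_eq_norm]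
    calc ‖ρ - (2 + (v : ℂ) * I)‖ = ‖(ρ - (1 + (v : ℂ) * I)) - 1‖ := by ring_nf
      _ ≤ ‖ρ - (1 + (v : ℂ) * I)‖ + ‖(1 : ℂ)‖ := norm_sub_le _ _
      _ ≤ r + 1 := by rw [norm_one]; linarith
      _ ≤ 31 / 16 := by linarith
  have hsub : W ⊆ (discZeros f v).filter (fun ρ => ‖ρ - (1 + (v : ℂ) * I)‖ ≤ r) := by
    intro ρ hρ; rw [mem_filter]; exact hmem ρ hρ
  calc ∑ ρ ∈ W, (zeroOrder f ρ : ℝ) = ∑ ρ ∈ W, (discDivisor f v ρ : ℝ) := by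
        refine sum_congr rfl fun ρ hρ => ?_
        rw [discDivisor_eq_zeroOrder hdf hfc ((mem_discZeros hdf hfc).1 (hmem ρ hρ).1).1]; norm_cast
    _ ≤ ∑ ρ ∈ (discZeros f v).filter (fun ρ => ‖ρ - (1 + (v : ℂ) * I)‖ ≤ r), (discDivisor f v ρ : ℝ) :=
        sum_le_sum_of_subset_of_nonneg hsub fun ρ _ _ => by exact_mod_cast discDivisor_nonneg hdf v ρ
    _ ≤ _ := localCount_dedekindZeta₁_le (K := K) v hr hr4

/-- **The zero side of Théorème 14 for `ζ₁_K`** (Bombieri pp. 49–50), `n_K ≤ 2`, away from the pole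
(`|γ| ≥ (4e^{10}+1) r` for the counted zeros): there are absolute `A₀, r₀, C > 0` such that for `ℒ'_v ≤ L'` on `|v| ≤ T'`,
`0 < r ≤ r₀`, `rL' ≥ 1`, `1 ≤ x`, `log x ≥ A₀ L'`, `z ≤ x^{a₀/2}`, and any finite set `Z` of zeros of
`L₀(·, χ)` with `1 − r/2 ≤ β < 1`, `|γ| + r/2 ≤ T'`,
`r · (e^{−10} x^{−r/10} r^{−3}/n_K²) · Σ_{ρ ∈ Z} m(ρ) ≤ C (rL') ∫_{−T'}^{T'} I_χ(v) dv`.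
[cite: Bombieri1987GrandCrible, §6 Théorème 14 (proof)] -/
theorem zeroSide_Z1 :
    ∃ A₀ r₀ C : ℝ, 0 < A₀ ∧ 0 < r₀ ∧ 0 < C ∧
      ∀ (K : Type*) [Field K] [NumberField K], Module.finrank ℚ K ≤ 2 →
        ∀ (T' r L' x : ℝ) (z : ℕ) (Zρ : Finset ℂ),
        (∀ v : ℝ, |v| ≤ T' → lemmaAHeight K v ≤ L') → 0 < r → r ≤ r₀ → 1 ≤ r * L' → 1 ≤ x →
        A₀ * L' ≤ Real.log x → (z : ℝ) ≤ x ^ (expoB / 2) → 0 ≤ T' →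
        (∀ ρ ∈ Zρ, dedekindZeta₁ K ρ = 0 ∧ 1 - r / 2 ≤ ρ.re ∧ ρ.re < 1 ∧ |ρ.im| + r / 2 ≤ T' ∧
            (4 * Real.exp 10 + 1) * r ≤ |ρ.im|) →
          r * (Real.exp (-10) / (2 * (Module.finrank ℚ K : ℝ)) ^ 2 * x ^ (-(r / 10)) / r ^ 3) *
              ∑ ρ ∈ Zρ, (zeroOrder (dedekindZeta₁ K) ρ : ℝ) ≤
            C * (r * L') * ∫ v in (-T')..T', meanValueCG (1 : ClassGroup (𝓞 K) →* ℂˣ) x z v := by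
  obtain ⟨A₀, r₀, hA₀, hr₀, hB⟩ := lemmeB_dedekindZeta₁
  refine ⟨A₀, min r₀ (1 / 4), 2 * 8, hA₀, by positivity, by positivity,
    fun K _ _ hnK T' r L' x z Zρ hLL' hr hrmin hu hx hlogx hz hT' hZ => ?_⟩
  classical
  set f := dedekindZeta₁ K with hf
  have hdf : Differentiable ℂ f := differentiable_dedekindZeta₁ K
  have hr0 : r ≤ r₀ := hrmin.trans (min_le_left _ _)
  have hr4 : r ≤ 1 / 4 := hrmin.trans (min_le_right _ _)
  set L₀ : ℝ := Real.exp (-10) / (2 * (Module.finrank ℚ K : ℝ)) ^ 2 * x ^ (-(r / 10)) / r ^ 3 with hL₀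
  set A : Set ℝ := Set.Icc (-T') T' with hA
  have hxpos : 0 < x := by linarith
  have hNX : 1 ≤ ⌊x ^ expoB⌋₊ := Nat.le_floor (by
    simp only [Nat.cast_one]; exact Real.one_le_rpow hx expoB_pos.le)
  have hint : IntegrableOn (meanValueCG (1 : ClassGroup (𝓞 K) →* ℂˣ) x z) A := integrableOn_meanValueCG _ hx z hNX _ _
  -- Lemme B at every `v` within `r/2` of the height of a zero of `Z`
  have hLB : ∀ ρ ∈ Zρ, ∀ v ∈ Set.Icc (ρ.im - r / 2) (ρ.im + r / 2), L₀ ≤ meanValueCG (1 : ClassGroup (𝓞 K) →* ℂˣ) x z v := by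
    intro ρ hρ v hv
    obtain ⟨h0, hβ, hβ1, hγT, hγlow⟩ := hZ ρ hρ
    have hvT : |v| ≤ T' := by
      rw [Set.mem_Icc] at hv
      have h1 : |ρ.im| ≤ T' - r / 2 := by linarith
      have h2 := abs_le.1 h1
      rw [abs_le]; constructor <;> linarith
    have hLL'v : lemmaAHeight K v ≤ L' := hLL' v hvT
    have hγ : |ρ.im - v| ≤ r / 2 := by
      rw [Set.mem_Icc] at hv; rw [abs_le]; constructor <;> linarith
    have hnorm : ‖ρ - (1 + (v : ℂ) * I)‖ ≤ r := by
      have hre : (ρ - (1 + (v : ℂ) * I)).re = ρ.re - 1 := by simp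
      have him : (ρ - (1 + (v : ℂ) * I)).im = ρ.im - v := by simp
      calc ‖ρ - (1 + (v : ℂ) * I)‖ ≤ |(ρ - (1 + (v : ℂ) * I)).re| + |(ρ - (1 + (v : ℂ) * I)).im| :=
            Complex.norm_le_abs_re_add_abs_im _
        _ ≤ r / 2 + r / 2 := by
            rw [hre, him]
            refine add_le_add ?_ hγ
            rw [abs_sub_comm, abs_of_nonneg (by linarith)]; linarith
        _ = r := by ring
    have hv : 4 * Real.exp 10 * r ≤ |v| := by
      rw [Set.mem_Icc] at hv
      have h1 : |ρ.im| - r / 2 ≤ |v| := by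
        have := abs_sub_abs_le_abs_sub ρ.im v
        have h2 : |ρ.im - v| ≤ r / 2 := hγ
        linarith
      nlinarith [Real.exp_pos (10:ℝ)]
    exact hB K hnK v r L' x z hLL'v hr hr0 hu hv ⟨ρ, h0, hnorm⟩ hxpos hlogx hz
  -- per zero: `r L₀ ≤ ∫_A 𝟙_{J_ρ} I`
  have hper : ∀ ρ ∈ Zρ, r * L₀ ≤
      ∫ v in A, (Set.Icc (ρ.im - r / 2) (ρ.im + r / 2)).indicator (meanValueCG (1 : ClassGroup (𝓞 K) →* ℂˣ) x z) v := by
    intro ρ hρ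
    obtain ⟨-, -, -, hγT, -⟩ := hZ ρ hρ
    set J : Set ℝ := Set.Icc (ρ.im - r / 2) (ρ.im + r / 2) with hJ
    have hJA : J ⊆ A := by
      intro v hv
      rw [hJ, Set.mem_Icc] at hv
      rw [hA, Set.mem_Icc]
      have h1 : |ρ.im| ≤ T' - r / 2 := by linarith
      have h2 := abs_le.1 h1
      constructor <;> linarith
    rw [setIntegral_indicator measurableSet_Icc, Set.inter_eq_right.2 hJA]
    have hvol : volume.real J = r := by
      rw [hJ, Measure.real, Real.volume_Icc, ENNReal.toReal_ofReal (by linarith)]; ring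
    have h := setIntegral_ge_of_const_le_real (c := L₀) measurableSet_Icc measure_Icc_lt_top.ne
      (fun v hv => hLB ρ hρ v hv) (hint.mono_set hJA)
    rw [hvol] at h
    linarith
  have hsum : r * L₀ * ∑ ρ ∈ Zρ, (zeroOrder f ρ : ℝ) ≤
      ∫ v in A, ∑ ρ ∈ Zρ, (zeroOrder f ρ : ℝ) *
        (Set.Icc (ρ.im - r / 2) (ρ.im + r / 2)).indicator (meanValueCG (1 : ClassGroup (𝓞 K) →* ℂˣ) x z) v := by
    rw [mul_sum, integral_finsetSum _ fun ρ _ => (hint.indicator measurableSet_Icc).const_mul _]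
    refine sum_le_sum fun ρ hρ => ?_
    rw [integral_const_mul]
    have h0 : (0 : ℝ) ≤ zeroOrder f ρ := Nat.cast_nonneg _
    calc r * L₀ * (zeroOrder f ρ : ℝ) = (zeroOrder f ρ : ℝ) * (r * L₀) := by ring
      _ ≤ _ := mul_le_mul_of_nonneg_left (hper ρ hρ) h0
  refine hsum.trans ?_
  have hℒ : ∀ v ∈ A, lemmaAHeight K v ≤ L' := by
    intro v hv
    rw [hA, Set.mem_Icc] at hv
    exact hLL' v (abs_le.2 ⟨hv.1, hv.2⟩)
  have hpt : ∀ v ∈ A, ∑ ρ ∈ Zρ, (zeroOrder f ρ : ℝ) *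
      (Set.Icc (ρ.im - r / 2) (ρ.im + r / 2)).indicator (meanValueCG (1 : ClassGroup (𝓞 K) →* ℂˣ) x z) v ≤
        (2 * 8 * (r * L')) * meanValueCG (1 : ClassGroup (𝓞 K) →* ℂˣ) x z v := by
    intro v hv
    have heq : ∑ ρ ∈ Zρ, (zeroOrder f ρ : ℝ) *
        (Set.Icc (ρ.im - r / 2) (ρ.im + r / 2)).indicator (meanValueCG (1 : ClassGroup (𝓞 K) →* ℂˣ) x z) v =
        (∑ ρ ∈ Zρ.filter (fun ρ => |ρ.im - v| ≤ r / 2), (zeroOrder f ρ : ℝ)) * meanValueCG (1 : ClassGroup (𝓞 K) →* ℂˣ) x z v := by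
      rw [sum_mul, sum_filter]
      refine sum_congr rfl fun ρ _ => ?_
      by_cases h : |ρ.im - v| ≤ r / 2
      · rw [if_pos h, Set.indicator_of_mem]
        rw [Set.mem_Icc]; rw [abs_le] at h; constructor <;> linarith
      · rw [if_neg h, Set.indicator_of_notMem, mul_zero]
        rw [Set.mem_Icc]; intro h'; exact h (abs_le.2 ⟨by linarith, by linarith⟩)
    rw [heq]
    refine mul_le_mul_of_nonneg_right ?_ (meanValueCG_nonneg _ x z v)
    have h1 := overlap_le_Z1 (K := K) hr hr4 Zρ (fun ρ hρ => ⟨(hZ ρ hρ).1, (hZ ρ hρ).2.1, (hZ ρ hρ).2.2.1⟩) v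
    have h2 : 8 * (1 + r * lemmaAHeight K v) ≤ 2 * 8 * (r * L') := by
      have := hℒ v hv
      have h3 : r * lemmaAHeight K v ≤ r * L' := mul_le_mul_of_nonneg_left this hr.le
      nlinarith [hu]
    exact h1.trans h2
  have hi1 : IntegrableOn (fun v => ∑ ρ ∈ Zρ, (zeroOrder f ρ : ℝ) *
      (Set.Icc (ρ.im - r / 2) (ρ.im + r / 2)).indicator (meanValueCG (1 : ClassGroup (𝓞 K) →* ℂˣ) x z) v) A :=
    integrable_finsetSum _ fun ρ _ => (hint.indicator measurableSet_Icc).const_mul _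
  calc ∫ v in A, ∑ ρ ∈ Zρ, (zeroOrder f ρ : ℝ) *
        (Set.Icc (ρ.im - r / 2) (ρ.im + r / 2)).indicator (meanValueCG (1 : ClassGroup (𝓞 K) →* ℂˣ) x z) v
      ≤ ∫ v in A, (2 * 8 * (r * L')) * meanValueCG (1 : ClassGroup (𝓞 K) →* ℂˣ) x z v :=
        setIntegral_mono_on hi1 (hint.const_mul _) measurableSet_Icc hpt
    _ = (2 * 8 * (r * L')) * ∫ v in (-T')..T', meanValueCG (1 : ClassGroup (𝓞 K) →* ℂˣ) x z v := by
        rw [integral_const_mul, hA, integral_Icc_eq_integral_Ioc,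
          ← intervalIntegral.integral_of_le (by linarith)]


/-! ### The middle range for `ζ₁_K` -/

omit [NumberField K] in
/-- `χ_0 = 1`. [folklore] -/
theorem toHomUnits_toMulHom_zero : (toMulHom (0 : AddChar (Additive (ClassGroup (𝓞 K))) ℂ)).toHomUnits = 1 := by
  refine MonoidHom.ext fun C ↦ Units.ext ?_
  rw [toHomUnits_toMulHom_apply]; simp

set_option maxHeartbeats 1600000 in
open scoped Classical in
/-- **Théorème 14 for `ζ₁_K` in the middle range** (degree `n_K ≤ 2`): for every `c₀ > 0` there are
absolute `δ₀, A, C > 0` such that for every `K` with `n_K ≤ 2`, `P ≥ 2` with `|d_K| ≤ P`, `h_K ≤ P`,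
`κ_K ≥ 1/P`, every finite set `Z` of zeros of `ζ_K` in `0 < β < 1`, `|γ| ≤ P`, and
`c₀/log P ≤ 1 − α ≤ δ₀`: `Σ_{ρ ∈ Z, β ≥ α} m(ρ) ≤ C P^{A(1−α)}` (zeros with `|γ| ≥ (4e^{10}+1) r`,
`r = 2(1−α)`, by `zeroSide_Z1` and the `ψ = 0` term of the sieve side; the others by the Lemme de
densité about `s = 1`). [cite: Bombieri1987GrandCrible, §6 Théorème 14] -/
theorem middleRange_Z1 {c₀ : ℝ} (hc₀ : 0 < c₀) :
    ∃ δ₀ A C : ℝ, 0 < δ₀ ∧ 0 < A ∧ 0 < C ∧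
      ∀ (K : Type*) [Field K] [NumberField K], Module.finrank ℚ K ≤ 2 →
        ∀ P : ℝ, 2 ≤ P → ((NumberField.discr K).natAbs : ℝ) ≤ P →
          (Fintype.card (ClassGroup (𝓞 K)) : ℝ) ≤ P → P⁻¹ ≤ NumberField.dedekindZeta_residue K →
        ∀ Z : Finset ℂ, (∀ ρ ∈ Z, dedekindZeta₁ K ρ = 0 ∧ 0 < ρ.re ∧ ρ.re < 1 ∧ |ρ.im| ≤ P) →
          ∀ α : ℝ, c₀ / Real.log P ≤ 1 - α → 1 - α ≤ δ₀ →
            ∑ ρ ∈ Z with α ≤ ρ.re, (zeroOrder (dedekindZeta₁ K) ρ : ℝ) ≤ C * P ^ (A * (1 - α)) := by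
  obtain ⟨A₀, r₀, C_z, hA₀, hr₀, hC_z, hZS⟩ := zeroSide_Z1
  set A'' : ℝ := 4 * Real.exp 10 + 1 with hA''
  have hA''pos : 0 < A'' := by positivity
  set a : ℝ := expoB with ha
  have hapos : 0 < a := expoB_pos
  have ha1 : a ≤ 1 / 2 := expoB_le_half
  set B : ℝ := max 84839040 (max 8 (1 / (2 * c₀))) with hB
  have hB0 : (84839040 : ℝ) ≤ B := le_max_left _ _
  have hB8 : 8 ≤ B := (le_max_left _ _).trans (le_max_right _ _)
  have hBc : 1 / (2 * c₀) ≤ B := (le_max_right _ _).trans (le_max_right _ _)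
  have hBpos : 0 < B := by linarith
  set A₁ : ℝ := max A₀ (2200 / (a * B)) with hA₁
  have hA₁pos : 0 < A₁ := lt_of_lt_of_le hA₀ (le_max_left _ _)
  have hA₁A₀ : A₀ ≤ A₁ := le_max_left _ _
  have hA₁a : 2200 / (a * B) ≤ A₁ := le_max_right _ _
  set C_M : ℝ := 512 * Real.exp 4 / a + 1 with hC_M
  have hC_Mpos : 0 < C_M := by positivity
  set K₁ : ℝ := 256 * π * C_z * C_M * A₁ ^ 2 * B ^ 3 with hK₁
  refine ⟨min (min (r₀ / 2) (1 / 2)) (1 / (8 * (A'' + 1))), (A₁ * B / 10 + 3) * 2 + 2 * B,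
    K₁ * Real.exp 10 + 8 * (A'' + 2),
    by positivity, by positivity, by positivity, fun K _ _ hnK P hP hd hh hκ Z hZ α hα1 hα2 => ?_⟩
  have hnK4 : Module.finrank ℚ K ≤ 4 := hnK.trans (by norm_num)
  /- ── parameters (as in `middleRange_CG`) ── -/
  have hPpos : 0 < P := by linarith
  have hP1 : 1 ≤ P := by linarith
  set Lp : ℝ := Real.log P with hLp
  have hLp2 : Real.log 2 ≤ Lp := Real.log_le_log (by norm_num) hP
  have hlog2 : (0.69 : ℝ) ≤ Real.log 2 := by have := Real.log_two_gt_d9; linarith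
  have hLppos : 0 < Lp := by linarith
  set r : ℝ := 2 * (1 - α) with hr
  have hδ : 1 - α ≤ r₀ / 2 := hα2.trans ((min_le_left _ _).trans (min_le_left _ _))
  have hδ' : 1 - α ≤ 1 / 2 := hα2.trans ((min_le_left _ _).trans (min_le_right _ _))
  have hδ'' : 1 - α ≤ 1 / (8 * (A'' + 1)) := hα2.trans (min_le_right _ _)
  have h1α : c₀ / Lp ≤ 1 - α := hα1
  have h1αpos : 0 < 1 - α := lt_of_lt_of_le (by positivity) h1α
  have hrpos : 0 < r := by rw [hr]; linarith
  have hrr₀ : r ≤ r₀ := by rw [hr]; linarith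
  have hr1 : r ≤ 1 := by rw [hr]; linarith
  have hrA'' : (A'' + 1) * r ≤ 1 / 4 := by
    rw [hr]; rw [le_div_iff₀ (by positivity)] at hδ''; nlinarith
  set L' : ℝ := B * Lp with hL'
  have hL'8 : 8 * Lp ≤ L' := by rw [hL']; exact mul_le_mul_of_nonneg_right hB8 hLppos.le
  have hL'1 : 1 ≤ L' := by linarith
  have hu : 1 ≤ r * L' := by
    rw [hr, hL']
    have h1 : c₀ ≤ (1 - α) * Lp := by rwa [div_le_iff₀ hLppos] at h1α
    have h2 : 1 ≤ 2 * c₀ * B := by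
      rw [div_le_iff₀ (by positivity)] at hBc; linarith
    calc (1 : ℝ) ≤ 2 * c₀ * B := h2
      _ ≤ 2 * ((1 - α) * Lp) * B := by nlinarith only [h1, hBpos, hc₀]
      _ = 2 * (1 - α) * (B * Lp) := by ring
  set Lx : ℝ := A₁ * L' with hLx
  set x : ℝ := Real.exp Lx with hx
  have hxpos : 0 < x := Real.exp_pos _
  have hlogx : Real.log x = Lx := Real.log_exp _
  have hLxA₀ : A₀ * L' ≤ Real.log x := by
    rw [hlogx, hLx]; exact mul_le_mul_of_nonneg_right hA₁A₀ (by positivity)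
  have haLx : 2200 * Lp ≤ a * Lx := by
    rw [hLx, hL']
    have h1 : 2200 / (a * B) * (B * Lp) ≤ A₁ * (B * Lp) :=
      mul_le_mul_of_nonneg_right hA₁a (by positivity)
    have h2 : a * (2200 / (a * B) * (B * Lp)) = 2200 * Lp := by field_simp
    calc 2200 * Lp = a * (2200 / (a * B) * (B * Lp)) := h2.symm
      _ ≤ a * (A₁ * (B * Lp)) := mul_le_mul_of_nonneg_left h1 hapos.le
  have haLx1500 : 1500 ≤ a * Lx := by linarith
  have hLxnn : 0 ≤ Lx := by rw [hLx]; positivity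
  have hLx4 : 4 ≤ Lx := by nlinarith only [ha1, hLxnn, haLx1500, hapos]
  have hLx1 : 1 ≤ Lx := by linarith
  have hx1 : 1 ≤ x := by rw [hx]; exact Real.one_le_exp (by linarith)
  set T' : ℝ := P + 1 with hT'
  have hT'1 : 1 ≤ T' := by rw [hT']; linarith
  have hT'0 : 0 ≤ T' := by linarith
  have hT'pos : 0 < T' := by linarith
  have hT'2 : T' ≤ 2 * P := by rw [hT']; linarith
  /- ── `NX`, `w`, `z` ── -/
  set NX : ℕ := ⌊x ^ a⌋₊ with hNX
  have hxa : x ^ a = Real.exp (a * Lx) := by rw [hx, ← Real.exp_mul, mul_comm]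
  have hxa512 : (512 : ℝ) ≤ x ^ a := by
    rw [hxa]; linarith [Real.add_one_le_exp (a * Lx)]
  have hNXle : (NX : ℝ) ≤ x ^ a := Nat.floor_le (by positivity)
  have hNXgt : x ^ a < NX + 1 := Nat.lt_floor_add_one _
  have hNXhalf : x ^ a / 2 ≤ NX := by linarith
  have hNX256 : (256 : ℝ) ≤ NX := by linarith
  have hNX1 : 1 ≤ NX := by exact_mod_cast (show (1 : ℝ) ≤ NX by linarith)
  have hNXpos : (0 : ℝ) < NX := by linarith
  have hlogNX : a * Lx - 1 ≤ Real.log NX := by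
    have h1 : Real.log (x ^ a / 2) ≤ Real.log NX := Real.log_le_log (by positivity) hNXhalf
    rw [Real.log_div (by positivity) two_ne_zero, hxa, Real.log_exp] at h1
    have := Real.log_two_lt_d9
    linarith
  obtain ⟨w, hw⟩ : ∃ w : ℝ, w = (NX : ℝ) ^ ((1 : ℝ) / 8) := ⟨_, rfl⟩
  have hw0 : 0 < w := by rw [hw]; exact Real.rpow_pos_of_pos hNXpos _
  have hw8 : w ^ 8 = NX := by
    rw [hw, ← Real.rpow_natCast, ← Real.rpow_mul hNXpos.le]; norm_num
  have hw2 : 2 ≤ w := by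
    have : (2 : ℝ) ^ 8 ≤ w ^ 8 := by
      rw [hw8]
      calc (2 : ℝ) ^ 8 = 256 := by norm_num
        _ ≤ NX := hNX256
    exact le_of_pow_le_pow_left₀ (by norm_num) hw0.le this
  have hlogw : Real.log w = Real.log NX / 8 := by
    rw [hw, Real.log_rpow hNXpos]; ring
  set z : ℕ := ⌊w⌋₊ with hz
  have hzle : (z : ℝ) ≤ w := Nat.floor_le hw0.le
  have hzgt : w < z + 1 := Nat.lt_floor_add_one _
  have hz1r : (1 : ℝ) ≤ z := by
    have : (1 : ℕ) ≤ z := Nat.le_floor (by simp only [Nat.cast_one]; linarith)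
    exact_mod_cast this
  have hz1 : 1 ≤ z := by exact_mod_cast hz1r
  have hzpos : (0 : ℝ) < z := by linarith
  have hz8 : (z : ℝ) ^ 8 ≤ NX := by rw [← hw8]; exact pow_le_pow_left₀ (Nat.cast_nonneg z) hzle 8
  have hzhalfw : w / 2 ≤ z := by linarith
  have hlogz : a * Lx / 8 - 1 ≤ Real.log z := by
    have h1 : Real.log (w / 2) ≤ Real.log z := Real.log_le_log (by positivity) hzhalfw
    rw [Real.log_div hw0.ne' two_ne_zero, hlogw] at h1
    have := Real.log_two_lt_d9
    linarith
  have hw_le_NX : w ≤ NX := by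
    rw [hw]
    calc (NX : ℝ) ^ ((1 : ℝ) / 8) ≤ (NX : ℝ) ^ (1 : ℝ) :=
          Real.rpow_le_rpow_of_exponent_le (by exact_mod_cast hNX1) (by norm_num)
      _ = NX := Real.rpow_one _
  have hzNX : z ≤ NX := by exact_mod_cast hzle.trans hw_le_NX
  have hzhalf : (z : ℝ) ≤ x ^ (expoB / 2) := by
    rw [← ha]
    calc (z : ℝ) ≤ w := hzle
      _ = (NX : ℝ) ^ ((1 : ℝ) / 8) := hw
      _ ≤ (NX : ℝ) ^ ((1 : ℝ) / 2) := Real.rpow_le_rpow_of_exponent_le (by exact_mod_cast hNX1) (by norm_num)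
      _ ≤ (x ^ a) ^ ((1 : ℝ) / 2) := Real.rpow_le_rpow (Nat.cast_nonneg _) hNXle (by norm_num)
      _ = x ^ (a / 2) := by rw [← Real.rpow_mul hxpos.le]; ring_nf
  /- ── kernel parameters and the saving ── -/
  set nK : ℕ := Module.finrank ℚ K with hnK'
  set m : ℕ := nK + 3 with hm
  have hm3 : Module.finrank ℚ K + 3 ≤ m := le_rfl
  have hn4 : (nK : ℝ) ≤ 4 := by exact_mod_cast hnK4
  have hmcast : (m : ℝ) = nK + 3 := by rw [hm]; push_cast; ring
  have hm8 : (m : ℝ) + 1 ≤ 8 := by rw [hmcast]; linarith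
  have hA2 : 0 < 2 * T' := by positivity
  have hTA : ((m : ℝ) + 1) * T' ^ 2 ≤ 3 * (2 * T') ^ 2 := by nlinarith only [hm8, sq_nonneg T']
  have hmA : ((m : ℝ) + 1) / (2 * T') ≤ 4 := by
    rw [div_le_iff₀ hA2]; linarith
  obtain ⟨u₀, hu₀def⟩ : ∃ u : ℝ, u = balancePoint K (2 * T') m := ⟨_, rfl⟩
  have hu₀ : Fintype.card (ClassGroup (𝓞 K)) * lemma44Err K (2 * T') m u₀ ≤ NumberField.dedekindZeta_residue K / 2 := by
    rw [hu₀def]; exact (card_mul_lemma44Err_balancePoint (K := K) (2 * T') m).le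
  have hu₀le : u₀ ≤ 100 * Lp := by rw [hu₀def]; exact balancePoint_le hP hT'1 hT'2 hnK4 hd hh hκ
  have hden : a * Lx / 16 ≤ Real.log z - u₀ - ((m : ℝ) + 1) / (2 * T') := by linarith
  have hden1 : 1 ≤ Real.log z - u₀ - ((m : ℝ) + 1) / (2 * T') := by linarith
  have hM : (Fintype.card (ClassGroup (𝓞 K)) : ℝ) * meanValueConst K (2 * T') m z NX ≤ C_M / Lx := by
    have h1 := card_mul_meanValueConst_le (K := K) hA2 hm3 hz1r (NX : ℝ) hu₀ hden1
    have h2 := secondary_le (K := K) hP hT'1 hT'2 hnK4 hd hh hzpos.le hz8 (by exact_mod_cast hNX1)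
    rw [← hw] at h2
    have hmain : 4 * ((m : ℝ) + 1) * Real.exp nK / (Real.log z - u₀ - ((m : ℝ) + 1) / (2 * T')) ≤ 512 * Real.exp 4 / a / Lx := by
      have hnum : 4 * ((m : ℝ) + 1) * Real.exp nK ≤ 32 * Real.exp 4 := by
        have he : Real.exp nK ≤ Real.exp 4 := Real.exp_le_exp.mpr hn4
        have h0 : 0 ≤ Real.exp (nK : ℝ) := (Real.exp_pos _).le
        have h4 : 0 < Real.exp (4 : ℝ) := Real.exp_pos _
        nlinarith only [hm8, he, h0, h4]
      have h1 : 4 * ((m : ℝ) + 1) * Real.exp nK / (Real.log z - u₀ - ((m : ℝ) + 1) / (2 * T')) ≤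
          32 * Real.exp 4 / (a * Lx / 16) := div_le_div₀ (by positivity) hnum (by positivity) hden
      refine h1.trans (le_of_eq ?_)
      field_simp
      ring
    have hsec : P ^ 111 * w⁻¹ ≤ 1 / Lx := by
      have hlogLx : Real.log Lx ≤ a * Lx / 16 := by
        have : 1500 / expoB ≤ Lx := by rw [div_le_iff₀ hapos, mul_comm]; exact haLx1500
        exact log_le_expoB_mul this
      have hwlow : P ^ 111 * Lx ≤ w := by
        have h3 : Real.log (P ^ 111 * Lx) ≤ Real.log w := by
          rw [Real.log_mul (by positivity) (by positivity), Real.log_pow, hlogw]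
          push_cast
          linarith
        exact (Real.log_le_log_iff (by positivity) hw0).mp h3
      have hinv : w⁻¹ ≤ (P ^ 111 * Lx)⁻¹ := inv_anti₀ (by positivity) hwlow
      calc P ^ 111 * w⁻¹ ≤ P ^ 111 * (P ^ 111 * Lx)⁻¹ := mul_le_mul_of_nonneg_left hinv (by positivity)
        _ = 1 / Lx := by field_simp
    calc (Fintype.card (ClassGroup (𝓞 K)) : ℝ) * meanValueConst K (2 * T') m z NX
        ≤ _ := h1
      _ ≤ 512 * Real.exp 4 / a / Lx + 1 / Lx := add_le_add hmain (h2.trans hsec)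
      _ = C_M / Lx := by rw [hC_M]; field_simp
  /- ── the sieve side: the `ψ = 0` term ── -/
  set Bt : ℝ := 16 * π * C_M * Lx with hBt
  have hsieve : ∀ t ∈ Set.Ioc (NX : ℝ) x,
      ∫ v in (-T')..T', ‖summatory (coefSiftedB (coefB K (1 : ClassGroup (𝓞 K) →* ℂˣ) v) x z) t‖ ^ 2 ≤ Bt := by
    intro t ht
    have hall := sieveSide_classGroup (K := K) x hz1 hzNX hT'pos hA2 hm3 hTA t
    -- the `ψ = 0` term is at most the full sum
    have hterm : ∫ v in (-T')..T', ‖summatory (coefSiftedB (coefB K (1 : ClassGroup (𝓞 K) →* ℂˣ) v) x z) t‖ ^ 2 ≤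
        ∑ ψ : AddChar (Additive (ClassGroup (𝓞 K))) ℂ,
          ∫ v in (-T')..T', ‖summatory (coefSiftedB (coefB K (toMulHom ψ).toHomUnits v) x z) t‖ ^ 2 := by
      rw [← toHomUnits_toMulHom_zero (K := K)]
      refine Finset.single_le_sum (f := fun ψ : AddChar (Additive (ClassGroup (𝓞 K))) ℂ ↦
        ∫ v in (-T')..T', ‖summatory (coefSiftedB (coefB K (toMulHom ψ).toHomUnits v) x z) t‖ ^ 2) (fun ψ _ ↦ ?_) (mem_univ _)
      exact intervalIntegral.integral_nonneg (by linarith) fun v _ => by positivity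
    refine hterm.trans (hall.trans ?_)
    have h2 : ∑ n ∈ (siftedSet x z).filter (fun n => n ≤ ⌊t⌋₊), Λ n * Real.log n / n ≤ 2 * Lx ^ 2 := by
      have hsub : (siftedSet x z).filter (fun n => n ≤ ⌊t⌋₊) ⊆ Icc 1 ⌊x⌋₊ := by
        intro n hn
        rw [mem_filter] at hn
        obtain ⟨h1, h2, -⟩ := siftedSet_prop hn.1
        rw [mem_Icc]; omega
      refine (sum_le_sum_of_subset_of_nonneg hsub fun n _ _ => ?_).trans ?_
      · exact div_nonneg (mul_nonneg ArithmeticFunction.vonMangoldt_nonneg (Real.log_natCast_nonneg n)) (Nat.cast_nonneg n)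
      refine (sum_vonMangoldt_mul_log_div_le ⌊x⌋₊).trans ?_
      have hfl : Real.log ⌊x⌋₊ ≤ Lx := by
        rw [← hlogx]
        rcases Nat.eq_zero_or_pos ⌊x⌋₊ with h0 | hpos
        · rw [h0, Nat.cast_zero, Real.log_zero, hlogx]; linarith
        · exact Real.log_le_log (by exact_mod_cast hpos) (Nat.floor_le hxpos.le)
      have hfl0 : 0 ≤ Real.log ⌊x⌋₊ := Real.log_natCast_nonneg _
      have hl4 : Real.log 4 ≤ 1.4 := by
        have h : Real.log 4 = 2 * Real.log 2 := by
          rw [show (4:ℝ) = 2 ^ 2 by norm_num, Real.log_pow]; norm_num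
        rw [h]; have := Real.log_two_lt_d9; linarith
      have h5 : Real.log ⌊x⌋₊ * (Real.log ⌊x⌋₊ + Real.log 4 + 2) ≤ Lx * (Lx + 4) :=
        mul_le_mul hfl (by linarith) (by linarith [Real.log_nonneg (by norm_num : (1:ℝ) ≤ 4)]) hLxnn
      nlinarith only [h5, hLx4]
    have hnK1 : 1 / (Module.finrank ℚ K : ℝ) ≤ 1 := by
      rw [div_le_one (by exact_mod_cast Module.finrank_pos (R := ℚ) (M := K))]
      exact_mod_cast Module.finrank_pos (R := ℚ) (M := K)
    have hsum0 : 0 ≤ ∑ n ∈ (siftedSet x z).filter (fun n => n ≤ ⌊t⌋₊), Λ n * Real.log n / n :=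
      sum_nonneg fun n _ => div_nonneg (mul_nonneg ArithmeticFunction.vonMangoldt_nonneg (Real.log_natCast_nonneg n)) (Nat.cast_nonneg n)
    calc 8 * π * ((Fintype.card (ClassGroup (𝓞 K)) : ℝ) * meanValueConst K (2 * T') m z ⌊x ^ expoB⌋₊ *
          (1 / (Module.finrank ℚ K : ℝ) * ∑ n ∈ (siftedSet x z).filter (fun n => n ≤ ⌊t⌋₊), Λ n * Real.log n / n))
        ≤ 8 * π * (C_M / Lx * (1 * (2 * Lx ^ 2))) := by
          rw [← ha, ← hNX]
          refine mul_le_mul_of_nonneg_left ?_ (by positivity)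
          refine mul_le_mul hM (mul_le_mul hnK1 h2 hsum0 zero_le_one) (by positivity) (by positivity)
      _ = Bt := by rw [hBt]; field_simp; ring
  /- ── the zero side for the far zeros ── -/
  set L₀ : ℝ := Real.exp (-10) / (2 * (Module.finrank ℚ K : ℝ)) ^ 2 * x ^ (-(r / 10)) / r ^ 3 with hL₀
  have hnKpos : (0 : ℝ) < Module.finrank ℚ K := by exact_mod_cast Module.finrank_pos (R := ℚ) (M := K)
  have hL₀pos : 0 < L₀ := by rw [hL₀]; positivity
  have hLL' : ∀ v : ℝ, |v| ≤ T' → lemmaAHeight K v ≤ L' := by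
    intro v hv
    refine (lemmaAHeight_le hP hnK4 hd (by rw [hT'] at hv; exact hv)).trans ?_
    rw [hL']; exact mul_le_mul_of_nonneg_right hB0 hLppos.le
  set Zfar := (Z.filter fun ρ ↦ α ≤ ρ.re).filter (fun ρ ↦ A'' * r ≤ |ρ.im|) with hZfar
  set Znear := (Z.filter fun ρ ↦ α ≤ ρ.re).filter (fun ρ ↦ ¬ (A'' * r ≤ |ρ.im|)) with hZnear
  have hsplit : ∑ ρ ∈ Z with α ≤ ρ.re, (zeroOrder (dedekindZeta₁ K) ρ : ℝ) =
      ∑ ρ ∈ Zfar, (zeroOrder (dedekindZeta₁ K) ρ : ℝ) + ∑ ρ ∈ Znear, (zeroOrder (dedekindZeta₁ K) ρ : ℝ) := by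
    rw [hZfar, hZnear, ← sum_filter_add_sum_filter_not (Z.filter fun ρ ↦ α ≤ ρ.re) (fun ρ ↦ A'' * r ≤ |ρ.im|)]
  have hzero : r * L₀ * ∑ ρ ∈ Zfar, (zeroOrder (dedekindZeta₁ K) ρ : ℝ) ≤
      C_z * (r * L') * ∫ v in (-T')..T', meanValueCG (1 : ClassGroup (𝓞 K) →* ℂˣ) x z v := by
    refine hZS K hnK T' r L' x z _ hLL' hrpos hrr₀ hu hx1 hLxA₀ hzhalf hT'0 ?_
    intro ρ hρ
    rw [hZfar, mem_filter, mem_filter] at hρ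
    obtain ⟨⟨hρZ, hαρ⟩, hfar⟩ := hρ
    obtain ⟨h0, -, hre1, him⟩ := hZ ρ hρZ
    refine ⟨h0, by rw [hr]; linarith, hre1, ?_, by rw [hA''] at hfar; exact hfar⟩
    rw [hT', hr]; linarith
  /- ── the near zeros: within `(A''+1) r` of `s = 1` ── -/
  have hnear : ∑ ρ ∈ Znear, (zeroOrder (dedekindZeta₁ K) ρ : ℝ) ≤ 8 * (A'' + 2) * (r * L') := by
    set f := dedekindZeta₁ K with hf
    have hdf : Differentiable ℂ f := differentiable_dedekindZeta₁ K
    have hfc : f (2 + ((0 : ℝ) : ℂ) * I) ≠ 0 := dedekindZeta₁_two_add_ne_zero 0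
    set lam : ℝ := (A'' + 1) * r with hlam
    have hlam0 : 0 < lam := by positivity
    have hlam4 : lam ≤ 1 / 4 := hrA''
    have hmem : ∀ ρ ∈ Znear, ρ ∈ discZeros f 0 ∧ ‖ρ - (1 + ((0 : ℝ) : ℂ) * I)‖ ≤ lam := by
      intro ρ hρ
      rw [hZnear, mem_filter, mem_filter, not_le] at hρ
      obtain ⟨⟨hρZ, hαρ⟩, hnear⟩ := hρ
      obtain ⟨h0, hβ0, hβ1, -⟩ := hZ ρ hρZ
      have hnorm : ‖ρ - (1 + ((0 : ℝ) : ℂ) * I)‖ ≤ lam := by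
        have hre : (ρ - (1 + ((0 : ℝ) : ℂ) * I)).re = ρ.re - 1 := by simp
        have him' : (ρ - (1 + ((0 : ℝ) : ℂ) * I)).im = ρ.im := by simp
        calc ‖ρ - (1 + ((0 : ℝ) : ℂ) * I)‖ ≤ |(ρ - (1 + ((0 : ℝ) : ℂ) * I)).re| + |(ρ - (1 + ((0 : ℝ) : ℂ) * I)).im| :=
              Complex.norm_le_abs_re_add_abs_im _
          _ ≤ r / 2 + A'' * r := by
              rw [hre, him']
              refine add_le_add ?_ hnear.le
              rw [abs_sub_comm, abs_of_nonneg (by linarith)]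
              rw [hr]; linarith
          _ ≤ lam := by rw [hlam]; linarith
      refine ⟨(mem_discZeros hdf hfc).2 ⟨?_, h0⟩, hnorm⟩
      rw [Metric.mem_closedBall, dist_eq_norm]
      calc ‖ρ - (2 + ((0 : ℝ) : ℂ) * I)‖ = ‖(ρ - (1 + ((0 : ℝ) : ℂ) * I)) - 1‖ := by ring_nf
        _ ≤ ‖ρ - (1 + ((0 : ℝ) : ℂ) * I)‖ + ‖(1 : ℂ)‖ := norm_sub_le _ _
        _ ≤ lam + 1 := by rw [norm_one]; linarith
        _ ≤ 31 / 16 := by linarith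
    have hsub : Znear ⊆ (discZeros f 0).filter (fun ρ => ‖ρ - (1 + ((0 : ℝ) : ℂ) * I)‖ ≤ lam) := by
      intro ρ hρ; rw [mem_filter]; exact hmem ρ hρ
    have hcount := localCount_dedekindZeta₁_le (K := K) 0 hlam0 hlam4
    have hℒ0 : lemmaAHeight K 0 ≤ L' := hLL' 0 (by simp; linarith)
    calc ∑ ρ ∈ Znear, (zeroOrder f ρ : ℝ) = ∑ ρ ∈ Znear, (discDivisor f 0 ρ : ℝ) := by
          refine sum_congr rfl fun ρ hρ => ?_
          rw [discDivisor_eq_zeroOrder hdf hfc ((mem_discZeros hdf hfc).1 (hmem ρ hρ).1).1]; norm_cast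
      _ ≤ ∑ ρ ∈ (discZeros f 0).filter (fun ρ => ‖ρ - (1 + ((0 : ℝ) : ℂ) * I)‖ ≤ lam), (discDivisor f 0 ρ : ℝ) :=
          sum_le_sum_of_subset_of_nonneg hsub fun ρ _ _ => by exact_mod_cast discDivisor_nonneg hdf _ ρ
      _ ≤ 8 * (1 + lam * lemmaAHeight K 0) := hcount
      _ ≤ 8 * (1 + lam * L') := by
          have := mul_le_mul_of_nonneg_left hℒ0 hlam0.le; linarith
      _ ≤ 8 * (A'' + 2) * (r * L') := by rw [hlam]; nlinarith [hu, hA''pos]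
  /- ── Fubini and the sieve bound for the `ψ = 0` mean value ── -/
  have hNXx : (NX : ℝ) ≤ x := by
    refine hNXle.trans ?_
    exact Real.rpow_le_self_of_one_le hx1 (by linarith)
  have hstep3 : ∫ v in (-T')..T', meanValueCG (1 : ClassGroup (𝓞 K) →* ℂˣ) x z v ≤ Bt * Lx := by
    set g : ℝ → ℝ := fun t => (∫ v in (-T')..T', ‖summatory (coefSiftedB (coefB K (1 : ClassGroup (𝓞 K) →* ℂˣ) v) x z) t‖ ^ 2) / t with hg
    have hgi : IntegrableOn g (Set.Ioc (NX : ℝ) x) := integrableOn_inner_CG _ x z hNX1 hT'0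
    have heq : ∫ v in (-T')..T', meanValueCG (1 : ClassGroup (𝓞 K) →* ℂˣ) x z v = ∫ t in Set.Ioc (NX : ℝ) x, g t := by
      rw [hg]; exact integral_meanValueCG_eq _ x z hNX1 hT'0
    rw [heq]
    have hBtint : IntegrableOn (fun t : ℝ => Bt * t⁻¹) (Set.Ioc (NX : ℝ) x) := by
      refine ((continuousOn_const.mul (continuousOn_inv₀.mono ?_)).integrableOn_compact isCompact_Icc).mono_set
        Set.Ioc_subset_Icc_self
      intro t ht; exact (hNXpos.trans_le ht.1).ne'
    calc ∫ t in Set.Ioc (NX : ℝ) x, g t ≤ ∫ t in Set.Ioc (NX : ℝ) x, Bt * t⁻¹ := by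
          refine setIntegral_mono_on hgi hBtint measurableSet_Ioc fun t ht => ?_
          have ht0 : 0 < t := hNXpos.trans ht.1
          rw [hg]; dsimp only
          rw [div_eq_mul_inv]
          exact mul_le_mul_of_nonneg_right (hsieve t ht) (inv_nonneg.2 ht0.le)
      _ = Bt * Real.log (x / NX) := by
          rw [integral_const_mul, ← intervalIntegral.integral_of_le hNXx, integral_inv_of_pos hNXpos hxpos]
      _ ≤ Bt * Lx := by
          refine mul_le_mul_of_nonneg_left ?_ (by positivity)
          rw [Real.log_div hxpos.ne' hNXpos.ne', hlogx]
          linarith [Real.log_nonneg (show (1:ℝ) ≤ NX by exact_mod_cast hNX1)]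
  have hmain := hzero.trans (mul_le_mul_of_nonneg_left hstep3 (by positivity))
  /- ── the final arithmetic for the far zeros ── -/
  set S : ℝ := ∑ ρ ∈ Zfar, (zeroOrder (dedekindZeta₁ K) ρ : ℝ) with hS
  have hS0 : 0 ≤ S := sum_nonneg fun ρ _ => Nat.cast_nonneg _
  have hK : C_z * (r * L') * (Bt * Lx) = r * (K₁ * Lp ^ 3) / 16 := by
    rw [hBt, hLx, hL', hK₁]; field_simp; ring
  rw [hK] at hmain
  have hL₀low : Real.exp (-10) * x ^ (-(r / 10)) / r ^ 3 / 16 ≤ L₀ := by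
    have hn16 : (2 * (Module.finrank ℚ K : ℝ)) ^ 2 ≤ 16 := by
      have h4 : (Module.finrank ℚ K : ℝ) ≤ 2 := by exact_mod_cast hnK
      nlinarith only [h4, hnKpos]
    have heq : L₀ = Real.exp (-10) * x ^ (-(r / 10)) / r ^ 3 / (2 * (Module.finrank ℚ K : ℝ)) ^ 2 := by
      rw [hL₀]; field_simp
    rw [heq]
    exact div_le_div_of_nonneg_left (by positivity) (by positivity) hn16
  set L₁ : ℝ := Real.exp (-10) * x ^ (-(r / 10)) / r ^ 3 with hL₁
  have hL₁pos : 0 < L₁ := by positivity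
  have hdiv : S ≤ K₁ * Lp ^ 3 / L₁ := by
    have h1 : r * (L₁ / 16) * S ≤ r * (K₁ * Lp ^ 3) / 16 := by
      have := mul_le_mul_of_nonneg_left (mul_le_mul_of_nonneg_right hL₀low hS0) hrpos.le
      calc r * (L₁ / 16) * S = r * (Real.exp (-10) * x ^ (-(r / 10)) / r ^ 3 / 16 * S) := by rw [hL₁]; ring
        _ ≤ r * (L₀ * S) := this
        _ = r * L₀ * S := by ring
        _ ≤ _ := hmain
    rw [le_div_iff₀ hL₁pos]
    have h2 := le_of_mul_le_mul_left (show r * (L₁ / 16 * S) ≤ r * (K₁ * Lp ^ 3 / 16) by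
      calc r * (L₁ / 16 * S) = r * (L₁ / 16) * S := by ring
        _ ≤ r * (K₁ * Lp ^ 3) / 16 := h1
        _ = r * (K₁ * Lp ^ 3 / 16) := by ring) hrpos
    have h3 := mul_le_mul_of_nonneg_left h2 (by norm_num : (0:ℝ) ≤ 16)
    linarith
  have hxr : x ^ (r / 10) = Real.exp (A₁ * B / 10 * r * Lp) := by
    rw [hx, ← Real.exp_mul, hLx, hL']; ring_nf
  have hL₁eq : K₁ * Lp ^ 3 / L₁ = K₁ * Real.exp 10 * ((r * Lp) ^ 3 * x ^ (r / 10)) := by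
    rw [hL₁, Real.rpow_neg hxpos.le, Real.exp_neg]
    have hx10 : 0 < x ^ (r / 10) := by positivity
    field_simp
  have hcube : (r * Lp) ^ 3 ≤ Real.exp (3 * (r * Lp)) := cube_le_exp (by positivity)
  have hfar_final : S ≤ K₁ * Real.exp 10 * P ^ (((A₁ * B / 10 + 3) * 2 + 2 * B) * (1 - α)) := by
    refine hdiv.trans ?_
    rw [hL₁eq]
    have hPpow : P ^ ((A₁ * B / 10 + 3) * 2 * (1 - α)) =
        Real.exp (3 * (r * Lp)) * Real.exp (A₁ * B / 10 * r * Lp) := by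
      rw [Real.rpow_def_of_pos hPpos, ← Real.exp_add, ← hLp, hr]; ring_nf
    have hmono : P ^ ((A₁ * B / 10 + 3) * 2 * (1 - α)) ≤ P ^ (((A₁ * B / 10 + 3) * 2 + 2 * B) * (1 - α)) :=
      Real.rpow_le_rpow_of_exponent_le hP1 (by nlinarith only [hBpos, h1αpos])
    rw [hxr]
    refine mul_le_mul_of_nonneg_left ((le_of_le_of_eq ?_ hPpow.symm).trans hmono) (by positivity)
    exact mul_le_mul_of_nonneg_right hcube (Real.exp_pos _).le
  /- ── the near zeros: `8(A''+2) rL' ≤ 8(A''+2) P^{2B(1−α)}` ── -/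
  have hnear_final : ∑ ρ ∈ Znear, (zeroOrder (dedekindZeta₁ K) ρ : ℝ) ≤
      8 * (A'' + 2) * P ^ (((A₁ * B / 10 + 3) * 2 + 2 * B) * (1 - α)) := by
    refine hnear.trans (mul_le_mul_of_nonneg_left ?_ (by positivity))
    have hrL' : r * L' = 2 * B * (1 - α) * Lp := by rw [hr, hL']; ring
    calc r * L' ≤ Real.exp (r * L') := by linarith [Real.add_one_le_exp (r * L')]
      _ = P ^ (2 * B * (1 - α)) := by rw [Real.rpow_def_of_pos hPpos, ← hLp, hrL']; ring_nf
      _ ≤ P ^ (((A₁ * B / 10 + 3) * 2 + 2 * B) * (1 - α)) := by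
          refine Real.rpow_le_rpow_of_exponent_le hP1 ?_
          have : 0 ≤ (A₁ * B / 10 + 3) * 2 * (1 - α) := by positivity
          nlinarith only [this]
  rw [hsplit, add_mul]
  exact add_le_add hfar_final hnear_final

/-! ### The small and the trivial range, and Théorème 14 for `ζ₁_K` -/

omit [NumberField K] in
/-- A zero of analytic order `1` has `zeroOrder = 1`. [folklore] -/
theorem zeroOrder_eq_one_of_analyticOrderAt_eq_one {f : ℂ → ℂ} {ρ : ℂ} (h : analyticOrderAt f ρ = 1) :
    zeroOrder f ρ = 1 := by
  have hne : analyticOrderAt f ρ ≠ ⊤ := by rw [h]; exact ENat.one_ne_top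
  have : (zeroOrder f ρ : ℕ∞) = 1 := by rw [zeroOrder, Nat.cast_analyticOrderNatAt hne, h]
  exact_mod_cast this

open scoped Classical in
/-- **The range `1 − α < c₁/log P` for `ζ_K`**: the count is at most `1` (the Landau–Page package
`exists_exceptionalZero_const`, member `χ = 1`). [cite: ThornerZaman2019, Theorem 3.1] -/
theorem smallRange_Z1 (n : ℕ) :
    ∃ c₁ : ℝ, 0 < c₁ ∧
      ∀ (K : Type) [Field K] [NumberField K], Module.finrank ℚ K = n →
        ∀ P : ℝ, 2 ≤ P → ((NumberField.discr K).natAbs : ℝ) ≤ P →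
        ∀ Z : Finset ℂ, (∀ ρ ∈ Z, dedekindZeta₁ K ρ = 0 ∧ |ρ.im| ≤ P) →
        ∀ α : ℝ, 1 - α < c₁ / Real.log P →
          ∑ ρ ∈ Z with α ≤ ρ.re, (zeroOrder (dedekindZeta₁ K) ρ : ℝ) ≤ 1 := by
  obtain ⟨c, hc, hpack⟩ := exists_exceptionalZero_const n
  refine ⟨c / 4, by positivity, fun K _ _ hK P hP hd Z hZ α hα => ?_⟩
  obtain ⟨-, huniq, hsimple⟩ := hpack K hK
  have hPpos : 0 < P := by linarith
  set Lp : ℝ := Real.log P with hLp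
  have hLp2 : Real.log 2 ≤ Lp := Real.log_le_log (by norm_num) hP
  have hlog2 : (0.69 : ℝ) ≤ Real.log 2 := by have := Real.log_two_gt_d9; linarith
  have hLppos : 0 < Lp := by linarith
  have hregion : ∀ ρ ∈ Z, α ≤ ρ.re →
      ((((1 : ClassGroup (𝓞 K) →* ℂˣ) = 1 → dedekindZeta₁ K ρ = 0) ∧
          ((1 : ClassGroup (𝓞 K) →* ℂˣ) ≠ 1 → classGroupLFunction₀ K 1 ρ = 0)) ∧
          1 - c / (Real.log ((NumberField.discr K).natAbs : ℝ) + Real.log (|ρ.im| + 4)) < ρ.re) := by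
    intro ρ hρ hαρ
    obtain ⟨h0, him⟩ := hZ ρ hρ
    refine ⟨⟨fun _ ↦ h0, fun h ↦ absurd rfl h⟩, ?_⟩
    have hℒ : Real.log ((NumberField.discr K).natAbs : ℝ) + Real.log (|ρ.im| + 4) ≤ 4 * Lp := by
      have hd1 : (1 : ℝ) ≤ ((NumberField.discr K).natAbs : ℝ) := one_le_natAbs_discr
      have h1 : Real.log ((NumberField.discr K).natAbs : ℝ) ≤ Lp := Real.log_le_log (by linarith) hd
      have h2 : Real.log (|ρ.im| + 4) ≤ Real.log (3 * P) := Real.log_le_log (by positivity) (by linarith)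
      rw [Real.log_mul (by norm_num) hPpos.ne'] at h2
      have h3 : Real.log 3 ≤ 1.2 := by
        have he := Real.exp_one_gt_d9
        have hpos : (0 : ℝ) < 3 / Real.exp 1 := by positivity
        have h := Real.log_le_sub_one_of_pos hpos
        rw [Real.log_div (by norm_num) (Real.exp_pos 1).ne', Real.log_exp] at h
        have h4 : 3 / Real.exp 1 ≤ 3 / 2.7 := div_le_div_of_nonneg_left (by norm_num) (by norm_num) (by linarith)
        norm_num at h4
        linarith
      nlinarith
    have hℒpos : 0 < Real.log ((NumberField.discr K).natAbs : ℝ) + Real.log (|ρ.im| + 4) := by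
      have : 0 ≤ Real.log ((NumberField.discr K).natAbs : ℝ) := Real.log_natCast_nonneg _
      have : 1 ≤ Real.log (|ρ.im| + 4) := by
        rw [Real.le_log_iff_exp_le (by positivity)]
        have := Real.exp_one_lt_d9; have := abs_nonneg ρ.im; linarith
      linarith
    have h4 : c / 4 / Lp ≤ c / (Real.log ((NumberField.discr K).natAbs : ℝ) + Real.log (|ρ.im| + 4)) := by
      rw [div_div]
      exact div_le_div_of_nonneg_left hc.le hℒpos (by linarith)
    linarith
  set W := Z.filter (fun ρ ↦ α ≤ ρ.re) with hW
  have hone : ∀ ρ ∈ W, (zeroOrder (dedekindZeta₁ K) ρ : ℝ) = 1 := by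
    intro ρ hρ
    rw [hW, mem_filter] at hρ
    have h := (hsimple 1 ρ (hregion ρ hρ.1 hρ.2)).1 rfl
    rw [zeroOrder_eq_one_of_analyticOrderAt_eq_one h, Nat.cast_one]
  have hsingle : W.card ≤ 1 := by
    refine Finset.card_le_one.mpr fun ρ₁ h₁ ρ₂ h₂ ↦ ?_
    rw [hW, mem_filter] at h₁ h₂
    exact (huniq 1 1 ρ₁ ρ₂ (hregion ρ₁ h₁.1 h₁.2) (hregion ρ₂ h₂.1 h₂.2)).2
  calc ∑ ρ ∈ W, (zeroOrder (dedekindZeta₁ K) ρ : ℝ) = ∑ ρ ∈ W, (1 : ℝ) := sum_congr rfl hone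
    _ = (W.card : ℝ) := by rw [sum_const, nsmul_eq_mul, mul_one]
    _ ≤ 1 := by exact_mod_cast hsingle

open scoped Classical in
/-- **The trivial bound for `ζ_K`**: for `n_K ≤ 4`, `P ≥ 2`, `|d_K| ≤ P`, and a finite set `Z` of zeros of
`ζ_K` with `1/4 ≤ β ≤ 1`, `|γ| ≤ P`: `Σ_{ρ ∈ Z} m(ρ) ≤ C P²` (Jensen discs at the integer heights).
[cite: Bombieri1987GrandCrible, §6 Théorème 14 (proof)] -/
theorem largeRange_Z1 :
    ∃ C : ℝ, 0 < C ∧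
      ∀ (K : Type*) [Field K] [NumberField K], Module.finrank ℚ K ≤ 4 →
        ∀ P : ℝ, 2 ≤ P → ((NumberField.discr K).natAbs : ℝ) ≤ P →
        ∀ Z : Finset ℂ, (∀ ρ ∈ Z, dedekindZeta₁ K ρ = 0 ∧ 1 / 4 ≤ ρ.re ∧ ρ.re ≤ 1 ∧ |ρ.im| ≤ P) →
          ∑ ρ ∈ Z, (zeroOrder (dedekindZeta₁ K) ρ : ℝ) ≤ C * P ^ (2 : ℕ) := by
  refine ⟨32 * 44 * 5, by norm_num, fun K _ _ hnK P hP hd Z hZ => ?_⟩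
  have hPpos : 0 < P := by linarith
  set Lp : ℝ := Real.log P with hLp
  have hLp2 : Real.log 2 ≤ Lp := Real.log_le_log (by norm_num) hP
  have hlog2 : (0.69 : ℝ) ≤ Real.log 2 := by have := Real.log_two_gt_d9; linarith
  have hLppos : 0 < Lp := by linarith
  have hLpP : Lp ≤ P := by rw [hLp]; exact (Real.log_le_sub_one_of_pos hPpos).trans (by linarith)
  set M : ℤ := ⌈P⌉ + 1 with hM
  have hMle : (M : ℝ) ≤ P + 2 := by
    rw [hM]; push_cast; linarith [(Int.ceil_lt_add_one P).le]
  set J : Finset ℤ := Finset.Icc (-M) M with hJ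
  have hM0 : 0 ≤ M := by
    rw [hM]; have := Int.ceil_nonneg hPpos.le; omega
  have hcardJ : (J.card : ℝ) ≤ 5 * P := by
    have : (J.card : ℤ) = 2 * M + 1 := by
      rw [hJ, Int.card_Icc]; omega
    have hc : (J.card : ℝ) = 2 * M + 1 := by exact_mod_cast this
    rw [hc]; linarith
  have hdiscj : ∀ j ∈ J, discBound K j ≤ 44 * Lp := by
    intro j hj
    rw [hJ, Finset.mem_Icc] at hj
    have hjabs : |(j : ℝ)| ≤ P + 2 := by
      rw [abs_le]; constructor
      · have : (-M : ℝ) ≤ j := by exact_mod_cast hj.1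
        linarith
      · have : (j : ℝ) ≤ M := by exact_mod_cast hj.2
        linarith
    have hn4 : (Module.finrank ℚ K : ℝ) ≤ 4 := by exact_mod_cast hnK
    have hn0 : (0 : ℝ) ≤ Module.finrank ℚ K := Nat.cast_nonneg _
    have hd1 : (1 : ℝ) ≤ ((NumberField.discr K).natAbs : ℝ) := one_le_natAbs_discr
    have hlogd : Real.log ((NumberField.discr K).natAbs : ℝ) ≤ Lp := Real.log_le_log (by linarith) hd
    have hlogv : Real.log (|(j : ℝ)| + 7) ≤ 5 * Lp := by
      have h1 : Real.log (|(j : ℝ)| + 7) ≤ Real.log (6 * P) := Real.log_le_log (by positivity) (by linarith)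
      rw [Real.log_mul (by norm_num) hPpos.ne'] at h1
      have h5 : Real.log 6 ≤ 2 := by
        have : Real.log 6 ≤ Real.log (Real.exp 2) := by
          refine Real.log_le_log (by norm_num) ?_
          have := Real.exp_one_gt_d9
          have h : Real.exp 2 = Real.exp 1 * Real.exp 1 := by rw [← Real.exp_add]; norm_num
          rw [h]; nlinarith
        rwa [Real.log_exp] at this
      nlinarith
    have hlv0 : 0 ≤ Real.log (|(j : ℝ)| + 7) := le_trans zero_le_one (one_le_log_abs_add_seven (j : ℝ))
    rw [discBound]
    have hprod : ((Module.finrank ℚ K : ℝ) + 1) * Real.log (|(j : ℝ)| + 7) ≤ 5 * (5 * Lp) :=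
      mul_le_mul (by linarith) hlogv hlv0 (by norm_num)
    nlinarith
  set f := dedekindZeta₁ K with hf
  have hdf : Differentiable ℂ f := differentiable_dedekindZeta₁ K
  set g : ℂ → ℤ := fun ρ => ⌊ρ.im + 1 / 2⌋ with hg
  have hmaps : ∀ ρ ∈ Z, g ρ ∈ J := by
    intro ρ hρ
    obtain ⟨-, -, -, him⟩ := hZ ρ hρ
    rw [hJ, Finset.mem_Icc, hg]; dsimp only
    have h1 := abs_le.1 him
    have hc1 : (⌈P⌉ : ℝ) ≥ P := Int.le_ceil _
    constructor
    · rw [hM]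
      have : (-(⌈P⌉ + 1) : ℤ) ≤ ⌊ρ.im + 1 / 2⌋ := by
        rw [Int.le_floor]; push_cast; linarith
      linarith
    · rw [hM]
      have : ⌊ρ.im + 1 / 2⌋ < ⌈P⌉ + 1 + 1 := by
        rw [Int.floor_lt]; push_cast; linarith
      omega
  have hfib : ∀ j ∈ J, ∑ ρ ∈ Z.filter (fun ρ => g ρ = j), (zeroOrder f ρ : ℝ) ≤ 32 * (44 * Lp) := by
    intro j hj
    have hfc : f (2 + ((j : ℝ) : ℂ) * I) ≠ 0 := dedekindZeta₁_two_add_ne_zero (j : ℝ)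
    have hsub : Z.filter (fun ρ => g ρ = j) ⊆ discZeros f (j : ℝ) := by
      intro ρ hρ
      rw [mem_filter] at hρ
      obtain ⟨h0, hβ, hβ1, -⟩ := hZ ρ hρ.1
      refine (mem_discZeros hdf hfc).2 ⟨?_, h0⟩
      rw [Metric.mem_closedBall, dist_eq_norm]
      have hγ : |ρ.im - j| ≤ 1 / 2 := by
        have hgj := hρ.2
        rw [hg] at hgj; dsimp only at hgj
        have h1 := Int.floor_le (ρ.im + 1 / 2)
        have h2 := Int.lt_floor_add_one (ρ.im + 1 / 2)
        rw [hgj] at h1 h2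
        rw [abs_le]; constructor <;> linarith
      have hre : (ρ - (2 + ((j : ℝ) : ℂ) * I)).re = ρ.re - 2 := by simp
      have him' : (ρ - (2 + ((j : ℝ) : ℂ) * I)).im = ρ.im - j := by simp
      have hsq : ‖ρ - (2 + ((j : ℝ) : ℂ) * I)‖ ^ 2 ≤ (31 / 16 : ℝ) ^ 2 := by
        rw [Complex.sq_norm, Complex.normSq_apply, hre, him']
        have h1 : (ρ.re - 2) * (ρ.re - 2) ≤ (7 / 4) ^ 2 := by nlinarith
        have h2 : (ρ.im - j) * (ρ.im - j) ≤ (1 / 2) ^ 2 := by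
          have := abs_le.1 hγ; nlinarith
        nlinarith
      nlinarith [norm_nonneg (ρ - (2 + ((j : ℝ) : ℂ) * I))]
    calc ∑ ρ ∈ Z.filter (fun ρ => g ρ = j), (zeroOrder f ρ : ℝ)
        = ∑ ρ ∈ Z.filter (fun ρ => g ρ = j), (discDivisor f (j : ℝ) ρ : ℝ) := by
          refine sum_congr rfl fun ρ hρ => ?_
          rw [discDivisor_eq_zeroOrder hdf hfc ((mem_discZeros hdf hfc).1 (hsub hρ)).1]; norm_cast
      _ ≤ ∑ ρ ∈ discZeros f (j : ℝ), (discDivisor f (j : ℝ) ρ : ℝ) :=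
          sum_le_sum_of_subset_of_nonneg hsub fun ρ _ _ => by exact_mod_cast discDivisor_nonneg hdf _ ρ
      _ ≤ 32 * discBound K (j : ℝ) := sum_divisor_dedekindZeta₁_bigDisc_le (K := K) _
      _ ≤ 32 * (44 * Lp) := mul_le_mul_of_nonneg_left (hdiscj j hj) (by norm_num)
  rw [← Finset.sum_fiberwise_of_maps_to hmaps]
  calc ∑ j ∈ J, ∑ ρ ∈ Z.filter (fun ρ => g ρ = j), (zeroOrder f ρ : ℝ)
      ≤ ∑ _j ∈ J, 32 * (44 * Lp) := sum_le_sum hfib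
    _ = J.card * (32 * (44 * Lp)) := by rw [sum_const, nsmul_eq_mul]
    _ ≤ (5 * P) * (32 * (44 * Lp)) := mul_le_mul_of_nonneg_right hcardJ (by positivity)
    _ ≤ (5 * P) * (32 * (44 * P)) := by gcongr
    _ = 32 * 44 * 5 * P ^ (2 : ℕ) := by ring

open scoped Classical in
/-- **The log-free zero-density estimate for `ζ_K`, degree `n ≤ 2`** (Bombieri's Théorème 14 for the
trivial class group character; Thorner–Zaman 2017 Theorem 5.3 with `δ(χ) = 1`): there are
`c_D, C_D > 0` such that for every number field `K` of degree `n`, every `P ≥ 2` with `|d_K| ≤ P`,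
`h_K ≤ P`, `κ_K ≥ 1/P`, every finite set `Z` of zeros of `ζ_K` with `1/4 ≤ β < 1`, `|γ| ≤ P`, and all
`0 ≤ α ≤ 1`: `Σ_{ρ ∈ Z, β ≥ α} m(ρ) ≤ C_D P^{c_D(1−α)}`. [cite: Bombieri1987GrandCrible, §6 Théorème 14] -/
theorem logFreeDensity_dedekindZeta₁ (n : ℕ) (hn : n ≤ 2) :
    ∃ c_D C_D : ℝ, 0 < c_D ∧ 0 < C_D ∧
      ∀ (K : Type) [Field K] [NumberField K], Module.finrank ℚ K = n →
        ∀ P : ℝ, 2 ≤ P → ((NumberField.discr K).natAbs : ℝ) ≤ P →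
          (Fintype.card (ClassGroup (𝓞 K)) : ℝ) ≤ P → P⁻¹ ≤ NumberField.dedekindZeta_residue K →
        ∀ Z : Finset ℂ, (∀ ρ ∈ Z, dedekindZeta₁ K ρ = 0 ∧ 1 / 4 ≤ ρ.re ∧ ρ.re < 1 ∧ |ρ.im| ≤ P) →
          ∀ α : ℝ, 0 ≤ α → α ≤ 1 →
            ∑ ρ ∈ Z with α ≤ ρ.re, (zeroOrder (dedekindZeta₁ K) ρ : ℝ) ≤ C_D * P ^ (c_D * (1 - α)) := by
  obtain ⟨c₁, hc₁, hsmall⟩ := smallRange_Z1 n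
  obtain ⟨δ₀, A, C, hδ₀, hA, hC, hmid⟩ := middleRange_Z1 hc₁
  obtain ⟨C₃, hC₃, hlarge⟩ := largeRange_Z1
  refine ⟨max A (2 / δ₀), max (max 1 C) C₃, by positivity, by positivity,
    fun K _ _ hK P hP hd hh hκ Z hZ α hα0 hα1 => ?_⟩
  have hnK : Module.finrank ℚ K ≤ 2 := hK ▸ hn
  have hnK4 : Module.finrank ℚ K ≤ 4 := hnK.trans (by norm_num)
  have hP1 : 1 ≤ P := by linarith
  have hexp0 : 0 ≤ max A (2 / δ₀) * (1 - α) := mul_nonneg (by positivity) (by linarith)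
  have hPpow1 : 1 ≤ P ^ (max A (2 / δ₀) * (1 - α)) := Real.one_le_rpow hP1 hexp0
  rcases lt_or_ge (1 - α) (c₁ / Real.log P) with h1 | h1
  · refine (hsmall K hK P hP hd Z (fun ρ hρ ↦ ⟨(hZ ρ hρ).1, (hZ ρ hρ).2.2.2⟩) α h1).trans ?_
    calc (1 : ℝ) ≤ max (max 1 C) C₃ * 1 := by
          have : (1:ℝ) ≤ max (max 1 C) C₃ := (le_max_left _ _).trans' (le_max_left _ _)
          linarith
      _ ≤ _ := mul_le_mul_of_nonneg_left hPpow1 (by positivity)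
  rcases le_or_gt (1 - α) δ₀ with h2 | h2
  · refine (hmid K hnK P hP hd hh hκ Z (fun ρ hρ ↦ ?_) α h1 h2).trans ?_
    · obtain ⟨h0, hβ, hβ1, him⟩ := hZ ρ hρ
      exact ⟨h0, by linarith, hβ1, him⟩
    refine mul_le_mul ((le_max_right _ _).trans (le_max_left _ _)) ?_ (by positivity) (by positivity)
    exact Real.rpow_le_rpow_of_exponent_le hP1 (mul_le_mul_of_nonneg_right (le_max_left _ _) (by linarith))
  · have hsub : ∑ ρ ∈ Z with α ≤ ρ.re, (zeroOrder (dedekindZeta₁ K) ρ : ℝ) ≤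
        ∑ ρ ∈ Z, (zeroOrder (dedekindZeta₁ K) ρ : ℝ) :=
      sum_le_sum_of_subset_of_nonneg (filter_subset _ _) fun ρ _ _ => Nat.cast_nonneg _
    refine hsub.trans ((hlarge K hnK4 P hP hd Z (fun ρ hρ ↦ ?_)).trans ?_)
    · obtain ⟨h0, hβ, hβ1, him⟩ := hZ ρ hρ
      exact ⟨h0, hβ, hβ1.le, him⟩
    refine mul_le_mul (le_max_right _ _) ?_ (by positivity) (by positivity)
    rw [← Real.rpow_natCast]
    refine Real.rpow_le_rpow_of_exponent_le hP1 ?_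
    push_cast
    have : (2 : ℝ) ≤ 2 / δ₀ * (1 - α) := by
      rw [div_mul_eq_mul_div, le_div_iff₀ hδ₀]; nlinarith
    exact this.trans (mul_le_mul_of_nonneg_right (le_max_right _ _) (by linarith))

end Literature.NumberTheory.LFunctions.NumberField

end
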